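import Mathlib
import Literature.Barriers.ValiantsHypothesis.AlgebraicNaturalProofs
import Literature.Computability.AlgebraicComplexity.ArithCircuitProofs
import Literature.Computability.AlgebraicComplexity.IMMInVPProofs
import Literature.Computability.AlgebraicComplexity.HomogeneousComponentsComplexity
import Summits.ValiantsHypothesis.ValiantsHypothesis.Theorems.BarrierLeverPartitionMinorsHitByVPProductStates
import Summits.ValiantsHypothesis.ValiantsHypothesis.Theorems.BarrierLeverPartitionMinorsHitByVPStrataDoorPrelims

/-!
# Route BarrierLever — item `PartitionMinorsHitByVP` (stmt-ValiantsHypothesis-19717):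
# the TWIN-FREE LIFT (counterpart of the TT reduction R2, item 19588) and the degree-free
# bookkeeping (truncation to `SmallCircuits`)

Helper file (`--supports stmt-ValiantsHypothesis-19717`; cell valiant-natproofs, rung V4, 𝒟-side,
prover seat val-np-p6 gen 0). Definition-free. Closes NO item.

The TT calculus of items 19587/19588/19616 has two moves, the literal-pair split R1 and the twin-free
dimension reduction R2. For item 19717 the split R1 is the two-strata case of the strata door
(`…StrataDoor.partitionMinor_hit_of_strata`, weights `λ = ±e_a`, `μ = ±e_c`). This file supplies the
counterpart of R2: if `g` certifies the PROJECTED layout `((u i).erase a, (w j).erase c)` then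
`f = g₀ · (1 + x_a)(1 + y_c)`, where `g₀` is `g` with the variables `x_a, y_c` killed, certifies
`(u, w)` — its layout matrix EQUALS that of `g` on the projection — at cost `L(f) ≤ L(g) + 4`,
`deg f ≤ deg g + 2`. No injectivity hypothesis is needed (if the projection identifies two rows the
hypothesis is vacuous). Degrees may thus exceed `h + h` along a reduction; they are restored ONCE at
the end by truncation (`exists_smallCircuits_of_sized`: a degree-free witness of size `s` with
`(2h+2)²·s + 2h + 1 ≤ (h+h)^b` yields a witness in `SmallCircuits ℂ (h+h) b`, via
`…StrataDoor.coeff_truncate_partition` and `Literature…complexity_sum_homogeneousComponent_le`).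

With both moves additive, every R1/R2 reduction tree of TT can be replayed for item 19717 at cost
`O(h)` per node; what the budget `(h+h)^b` constrains is the NUMBER OF LEAVES (memo
RESIDUE-vs-19616-p6g0.md on item 19717).

* `coeff_killVars`, `killVars_eq_aeval`, `complexity_killVars_le`, `totalDegree_killVars_le` — the
  monomials of `g` avoiding two variables, as a polynomial.
* `coeff_mul_one_add_X_of_free` — for `p` free of the variable `t` and `m t ≤ 1`:
  `coeff_m (p · (1 + X t)) = coeff_{m.erase t} p`.
* `partitionExpo_erase_erase` — `(x^U y^W).erase y_c .erase x_a = x^{U ∖ a} y^{W ∖ c}`.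
* **`partitionMinor_hit_of_twinFreeLift`** — the lift (any index type `ι`).
* **`exists_smallCircuits_of_sized`** — degree-free witness of size `s` ⇒ witness in `SmallCircuits`.

WHAT THIS IS NOT: single reduction steps; nothing on which layouts reduce to few good leaves (the
content of item 19717), on crux 14610 or on VP vs VNP.
-/

set_option linter.dupNamespace false

namespace Summit.ValiantsHypothesis.ValiantsHypothesis.Theorems.BarrierLever.StrataDoor

open Finset
open Literature.Barriers.ValiantsHypothesis Literature.Computability.AlgebraicComplexity
open Summit.ValiantsHypothesis.ValiantsHypothesis.Theorems.BarrierLever.ProductStateSums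
  (castAdd_ne_natAdd partitionExpo_apply_castAdd partitionExpo_apply_natAdd)

/-! ## 1. Killing two variables -/

section Kill

variable {n : ℕ}

/-- Coefficients of the sub-sum of the monomials of `g` avoiding the variables `s₁, s₂`. -/
theorem coeff_killVars (s₁ s₂ : Fin n) (g : MvPolynomial (Fin n) ℂ) (m : Fin n →₀ ℕ) :
    MvPolynomial.coeff m (∑ d ∈ g.support with (d s₁ = 0 ∧ d s₂ = 0),
      MvPolynomial.monomial d (MvPolynomial.coeff d g)) =
      if m s₁ = 0 ∧ m s₂ = 0 then MvPolynomial.coeff m g else 0 := by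
  classical
  rw [MvPolynomial.coeff_sum]
  simp_rw [MvPolynomial.coeff_monomial]
  by_cases hm : m s₁ = 0 ∧ m s₂ = 0
  · rw [if_pos hm]
    by_cases hsupp : m ∈ g.support
    · rw [Finset.sum_eq_single m (fun d _ hd => if_neg hd) (fun h' => ?_), if_pos rfl]
      exact absurd (Finset.mem_filter.mpr ⟨hsupp, hm⟩) h'
    · rw [Finset.sum_eq_zero (fun d hd => ?_), MvPolynomial.notMem_support_iff.mp hsupp]
      rw [if_neg]
      rintro rfl
      exact hsupp (Finset.mem_filter.mp hd).1
  · rw [if_neg hm]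
    refine Finset.sum_eq_zero fun d hd => ?_
    rw [if_neg]
    rintro rfl
    exact hm (Finset.mem_filter.mp hd).2

/-- The sub-sum is the substitution killing `x_{s₁}` and `x_{s₂}`. -/
theorem killVars_eq_aeval (s₁ s₂ : Fin n) (g : MvPolynomial (Fin n) ℂ) :
    (∑ d ∈ g.support with (d s₁ = 0 ∧ d s₂ = 0),
      MvPolynomial.monomial d (MvPolynomial.coeff d g)) =
      MvPolynomial.aeval (fun i => if i = s₁ ∨ i = s₂ then (0 : MvPolynomial (Fin n) ℂ)
        else MvPolynomial.X i) g := by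
  classical
  conv_rhs => rw [g.as_sum]
  rw [map_sum, ← Finset.sum_filter_add_sum_filter_not g.support (fun d => d s₁ = 0 ∧ d s₂ = 0)]
  have hmon : ∀ d : Fin n →₀ ℕ, MvPolynomial.aeval (fun i => if i = s₁ ∨ i = s₂ then
      (0 : MvPolynomial (Fin n) ℂ) else MvPolynomial.X i) (MvPolynomial.monomial d (MvPolynomial.coeff d g)) =
      MvPolynomial.C (MvPolynomial.coeff d g) * ∏ i ∈ d.support,
        (if i = s₁ ∨ i = s₂ then (0 : MvPolynomial (Fin n) ℂ) else MvPolynomial.X i) ^ d i := by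
    intro d
    rw [MvPolynomial.aeval_monomial, Finsupp.prod]
    rfl
  rw [← add_zero (∑ d ∈ g.support with (d s₁ = 0 ∧ d s₂ = 0),
    MvPolynomial.monomial d (MvPolynomial.coeff d g))]
  congr 1
  · refine Finset.sum_congr rfl fun d hd => ?_
    obtain ⟨-, hd1, hd2⟩ := Finset.mem_filter.mp hd
    rw [hmon, MvPolynomial.monomial_eq, Finsupp.prod]
    congr 1
    refine Finset.prod_congr rfl fun i hi => ?_
    rw [if_neg]
    rintro (rfl | rfl)
    · exact (Finsupp.mem_support_iff.mp hi) hd1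
    · exact (Finsupp.mem_support_iff.mp hi) hd2
  · symm
    refine Finset.sum_eq_zero fun d hd => ?_
    obtain ⟨-, hd⟩ := Finset.mem_filter.mp hd
    rw [hmon]
    have : ∃ s, s ∈ d.support ∧ (s = s₁ ∨ s = s₂) := by
      by_cases h1 : d s₁ = 0
      · exact ⟨s₂, Finsupp.mem_support_iff.mpr (fun h2 => hd ⟨h1, h2⟩), Or.inr rfl⟩
      · exact ⟨s₁, Finsupp.mem_support_iff.mpr h1, Or.inl rfl⟩
    obtain ⟨s, hs, hs'⟩ := this
    rw [Finset.prod_eq_zero hs (by rw [if_pos hs', zero_pow (Finsupp.mem_support_iff.mp hs)]),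
      mul_zero]

/-- Killing variables is free. -/
theorem complexity_killVars_le (s₁ s₂ : Fin n) (g : MvPolynomial (Fin n) ℂ) :
    complexity (∑ d ∈ g.support with (d s₁ = 0 ∧ d s₂ = 0),
      MvPolynomial.monomial d (MvPolynomial.coeff d g)) ≤ complexity g := by
  rw [killVars_eq_aeval]
  refine (complexity_aeval_le _ _).trans ?_
  have h0 : ∑ i : Fin n, complexity ((if i = s₁ ∨ i = s₂ then (0 : MvPolynomial (Fin n) ℂ)
      else MvPolynomial.X i)) = 0 := by
    refine Finset.sum_eq_zero fun i _ => ?_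
    by_cases hi : i = s₁ ∨ i = s₂
    · rw [if_pos hi, ← MvPolynomial.C_0, complexity_C_holds]
    · rw [if_neg hi, complexity_X_holds]
  rw [h0, add_zero]

/-- Killing variables does not raise the degree. -/
theorem totalDegree_killVars_le (s₁ s₂ : Fin n) (g : MvPolynomial (Fin n) ℂ) :
    (∑ d ∈ g.support with (d s₁ = 0 ∧ d s₂ = 0),
      MvPolynomial.monomial d (MvPolynomial.coeff d g)).totalDegree ≤ g.totalDegree := by
  classical
  refine (MvPolynomial.totalDegree_finsetSum _ _).trans (Finset.sup_le fun d hd => ?_)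
  exact (MvPolynomial.totalDegree_monomial_le _ _).trans
    (MvPolynomial.le_totalDegree (Finset.mem_filter.mp hd).1)

/-- Multiplying a `t`-free polynomial by `1 + X t` READS OFF the `t`-erased coefficient
(for exponents with `m t ≤ 1`). -/
theorem coeff_mul_one_add_X_of_free (t : Fin n) (p : MvPolynomial (Fin n) ℂ)
    (hp : ∀ d ∈ p.support, d t = 0) (m : Fin n →₀ ℕ) (hm : m t ≤ 1) :
    MvPolynomial.coeff m (p * (1 + MvPolynomial.X t)) = MvPolynomial.coeff (m.erase t) p := by
  classical
  rw [mul_add, mul_one, MvPolynomial.coeff_add, MvPolynomial.coeff_mul_X']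
  by_cases ht : m t = 0
  · rw [if_neg (by rw [Finsupp.mem_support_iff]; exact fun h' => h' ht), add_zero,
      Finsupp.erase_of_notMem_support (by rw [Finsupp.mem_support_iff]; exact fun h' => h' ht)]
  · have h1 : m t = 1 := by omega
    have hmp : MvPolynomial.coeff m p = 0 := by
      rw [← MvPolynomial.notMem_support_iff]
      exact fun hh => ht (hp m hh)
    rw [hmp, zero_add, if_pos (by rw [Finsupp.mem_support_iff]; exact ht)]
    congr 1
    ext i
    rw [Finsupp.tsub_apply, Finsupp.erase_apply, Finsupp.single_apply]
    by_cases hi : i = t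
    · subst hi; simp [h1]
    · rw [if_neg (Ne.symm hi), if_neg hi, Nat.sub_zero]

end Kill

/-! ## 2. The lift -/

variable {h : ℕ}

/-- Erasing `y_c` then `x_a` from the partition exponent `x^U y^W` gives `x^{U.erase a} y^{W.erase c}`. -/
theorem partitionExpo_erase_erase (U W : Finset (Fin h)) (a c : Fin h) :
    (((∑ a' ∈ U, Finsupp.single (Fin.castAdd h a') 1 +
        ∑ c' ∈ W, Finsupp.single (Fin.natAdd h c') 1 : Fin (h + h) →₀ ℕ).erase
        (Fin.natAdd h c)).erase (Fin.castAdd h a)) =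
      ∑ a' ∈ U.erase a, Finsupp.single (Fin.castAdd h a') 1 +
        ∑ c' ∈ W.erase c, Finsupp.single (Fin.natAdd h c') 1 := by
  classical
  ext i
  rw [Finsupp.erase_apply, Finsupp.erase_apply]
  induction i using Fin.addCases with
  | left a' =>
    rw [partitionExpo_apply_castAdd, partitionExpo_apply_castAdd]
    rw [if_neg (castAdd_ne_natAdd a' c)]
    by_cases ha : a' = a
    · subst ha; simp
    · rw [if_neg (fun hh => ha (Fin.castAdd_inj.mp hh))]
      simp [Finset.mem_erase, ha]
  | right c' =>
    rw [partitionExpo_apply_natAdd, partitionExpo_apply_natAdd]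
    rw [if_neg (fun hh => castAdd_ne_natAdd a c' hh.symm)]
    by_cases hc : c' = c
    · subst hc; simp
    · rw [if_neg (fun hh => hc ((Fin.natAdd_inj _).mp hh))]
      simp [Finset.mem_erase, hc]

/-- **Twin-free lift** (counterpart of R2 for item 19717). If `g` has a nonsingular layout matrix on
the projected layout `((u i).erase a, (w j).erase c)`, then `f = g₀ (1 + x_a)(1 + y_c)` (with `g₀` =
`g` without the monomials containing `x_a` or `y_c`) has THE SAME matrix on `(u, w)`; `L(f) ≤ L(g) + 4`,
`deg f ≤ deg g + 2`. -/
theorem partitionMinor_hit_of_twinFreeLift {ι : Type*} [Fintype ι] [DecidableEq ι]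
    (u w : ι → Finset (Fin h)) (a c : Fin h) (g : MvPolynomial (Fin (h + h)) ℂ)
    (hg : (Matrix.of fun i j : ι => MvPolynomial.coeff
        (∑ a' ∈ (u i).erase a, Finsupp.single (Fin.castAdd h a') 1 +
          ∑ c' ∈ (w j).erase c, Finsupp.single (Fin.natAdd h c') 1) g).det ≠ 0) :
    ∃ f : MvPolynomial (Fin (h + h)) ℂ, complexity f ≤ complexity g + 4 ∧
      f.totalDegree ≤ g.totalDegree + 2 ∧
      (Matrix.of fun i j : ι => MvPolynomial.coeff
        (∑ a' ∈ u i, Finsupp.single (Fin.castAdd h a') 1 +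
          ∑ c' ∈ w j, Finsupp.single (Fin.natAdd h c') 1) f).det ≠ 0 := by
  classical
  set xa : Fin (h + h) := Fin.castAdd h a with hxa
  set yc : Fin (h + h) := Fin.natAdd h c with hyc
  set g₀ : MvPolynomial (Fin (h + h)) ℂ := ∑ d ∈ g.support with (d xa = 0 ∧ d yc = 0),
      MvPolynomial.monomial d (MvPolynomial.coeff d g) with hg₀
  set f : MvPolynomial (Fin (h + h)) ℂ :=
    g₀ * (1 + MvPolynomial.X xa) * (1 + MvPolynomial.X yc) with hf
  have hg₀free : ∀ d ∈ g₀.support, d xa = 0 ∧ d yc = 0 := by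
    intro d hd
    have := MvPolynomial.mem_support_iff.mp hd
    rw [hg₀, coeff_killVars] at this
    by_contra hh
    exact this (if_neg hh)
  have hg₁free : ∀ d ∈ (g₀ * (1 + MvPolynomial.X xa)).support, d yc = 0 := by
    intro d hd
    have := MvPolynomial.mem_support_iff.mp hd
    by_contra hh
    apply this
    rw [mul_add, mul_one, MvPolynomial.coeff_add, MvPolynomial.coeff_mul_X']
    have h1 : MvPolynomial.coeff d g₀ = 0 := by
      rw [← MvPolynomial.notMem_support_iff]
      exact fun hd' => hh (hg₀free d hd').2
    have h2 : MvPolynomial.coeff (d - Finsupp.single xa 1) g₀ = 0 := by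
      rw [← MvPolynomial.notMem_support_iff]
      intro hd'
      have := (hg₀free _ hd').2
      rw [Finsupp.tsub_apply, Finsupp.single_apply, if_neg (castAdd_ne_natAdd a c)] at this
      exact hh (by simpa using this)
    rw [h1, h2, zero_add, ite_self]
  have hcoef : ∀ U W : Finset (Fin h), MvPolynomial.coeff
      (∑ a' ∈ U, Finsupp.single (Fin.castAdd h a') 1 + ∑ c' ∈ W, Finsupp.single (Fin.natAdd h c') 1) f =
      MvPolynomial.coeff (∑ a' ∈ U.erase a, Finsupp.single (Fin.castAdd h a') 1 +
        ∑ c' ∈ W.erase c, Finsupp.single (Fin.natAdd h c') 1) g := by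
    intro U W
    have hm1 : ((∑ a' ∈ U, Finsupp.single (Fin.castAdd h a') 1 +
        ∑ c' ∈ W, Finsupp.single (Fin.natAdd h c') 1 : Fin (h + h) →₀ ℕ)) yc ≤ 1 := by
      rw [hyc, partitionExpo_apply_natAdd]; split_ifs <;> omega
    have hm2 : (((∑ a' ∈ U, Finsupp.single (Fin.castAdd h a') 1 +
        ∑ c' ∈ W, Finsupp.single (Fin.natAdd h c') 1 : Fin (h + h) →₀ ℕ)).erase yc) xa ≤ 1 := by
      rw [Finsupp.erase_apply, if_neg (castAdd_ne_natAdd a c), hxa, partitionExpo_apply_castAdd]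
      split_ifs <;> omega
    rw [hf, coeff_mul_one_add_X_of_free yc _ hg₁free _ hm1,
      coeff_mul_one_add_X_of_free xa _ (fun d hd => (hg₀free d hd).1) _ hm2, partitionExpo_erase_erase, hg₀, coeff_killVars,
      if_pos]
    constructor
    · rw [hxa, partitionExpo_apply_castAdd, if_neg (Finset.notMem_erase a U)]
    · rw [hyc, partitionExpo_apply_natAdd, if_neg (Finset.notMem_erase c W)]
  refine ⟨f, ?_, ?_, ?_⟩
  · -- size
    have hX : ∀ s : Fin (h + h), complexity (1 + MvPolynomial.X s : MvPolynomial (Fin (h + h)) ℂ) ≤ 1 :=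
      fun s => by
        calc _ ≤ complexity (1 : MvPolynomial (Fin (h + h)) ℂ) +
              complexity (MvPolynomial.X s : MvPolynomial (Fin (h + h)) ℂ) + 1 := complexity_add_le_holds _ _
          _ = 1 := by rw [← MvPolynomial.C_1, complexity_C_holds, complexity_X_holds]
    calc complexity f ≤ complexity (g₀ * (1 + MvPolynomial.X xa)) +
          complexity (1 + MvPolynomial.X yc : MvPolynomial (Fin (h + h)) ℂ) + 1 := complexity_mul_le_holds _ _
      _ ≤ (complexity g₀ + complexity (1 + MvPolynomial.X xa : MvPolynomial (Fin (h + h)) ℂ) + 1) +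
          1 + 1 := by
          gcongr
          · exact complexity_mul_le_holds _ _
          · exact hX yc
      _ ≤ (complexity g + 1 + 1) + 1 + 1 := by
          gcongr
          · exact complexity_killVars_le xa yc g
          · exact hX xa
      _ = complexity g + 4 := by ring
  · -- degree
    have hX : ∀ s : Fin (h + h), (1 + MvPolynomial.X s : MvPolynomial (Fin (h + h)) ℂ).totalDegree ≤ 1 :=
      fun s => (MvPolynomial.totalDegree_add _ _).trans (max_le (by simp) (by
        rw [MvPolynomial.totalDegree_X]))
    calc f.totalDegree ≤ (g₀ * (1 + MvPolynomial.X xa)).totalDegree +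
          (1 + MvPolynomial.X yc : MvPolynomial (Fin (h + h)) ℂ).totalDegree := MvPolynomial.totalDegree_mul _ _
      _ ≤ (g₀.totalDegree + (1 + MvPolynomial.X xa : MvPolynomial (Fin (h + h)) ℂ).totalDegree) + 1 := by
          gcongr
          · exact MvPolynomial.totalDegree_mul _ _
          · exact hX yc
      _ ≤ (g.totalDegree + 1) + 1 := by
          gcongr
          · exact totalDegree_killVars_le xa yc g
          · exact hX xa
  · -- the matrix is that of `g` on the projection
    have hM : (Matrix.of fun i j : ι => MvPolynomial.coeff
        (∑ a' ∈ u i, Finsupp.single (Fin.castAdd h a') 1 +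
          ∑ c' ∈ w j, Finsupp.single (Fin.natAdd h c') 1) f) =
        Matrix.of fun i j : ι => MvPolynomial.coeff
          (∑ a' ∈ (u i).erase a, Finsupp.single (Fin.castAdd h a') 1 +
            ∑ c' ∈ (w j).erase c, Finsupp.single (Fin.natAdd h c') 1) g := by
      ext i j
      rw [Matrix.of_apply, Matrix.of_apply, hcoef]
    rw [hM]
    exact hg

/-! ## 3. Degree-free witnesses and `SmallCircuits` -/

/-- **Truncation to `SmallCircuits`.** A degree-free witness `f` of size `≤ s` with
`(2h+2)²·s + (2h+1) ≤ (h+h)^b` yields a witness in `SmallCircuits ℂ (h+h) b` with the same layout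
matrix (any index type). -/
theorem exists_smallCircuits_of_sized {ι : Type*} [Fintype ι] [DecidableEq ι] (b s : ℕ)
    (u w : ι → Finset (Fin h)) (f : MvPolynomial (Fin (h + h)) ℂ) (hf : complexity f ≤ s)
    (hs : (h + h + 2) ^ 2 * s + (h + h + 1) ≤ (h + h) ^ b)
    (hdet : (Matrix.of fun i j : ι => MvPolynomial.coeff
        (∑ a' ∈ u i, Finsupp.single (Fin.castAdd h a') 1 +
          ∑ c' ∈ w j, Finsupp.single (Fin.natAdd h c') 1) f).det ≠ 0) :
    ∃ f' ∈ SmallCircuits ℂ (h + h) b, (Matrix.of fun i j : ι => MvPolynomial.coeff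
        (∑ a' ∈ u i, Finsupp.single (Fin.castAdd h a') 1 +
          ∑ c' ∈ w j, Finsupp.single (Fin.natAdd h c') 1) f').det ≠ 0 := by
  refine ⟨∑ e ∈ Finset.range (h + h + 1), MvPolynomial.homogeneousComponent e f,
    ⟨totalDegree_truncate_le f, ?_⟩, ?_⟩
  · refine (complexity_sum_homogeneousComponent_le f (h + h)).trans (le_trans ?_ hs)
    gcongr
  · have hM : (Matrix.of fun i j : ι => MvPolynomial.coeff
        (∑ a' ∈ u i, Finsupp.single (Fin.castAdd h a') 1 +
          ∑ c' ∈ w j, Finsupp.single (Fin.natAdd h c') 1)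
        (∑ e ∈ Finset.range (h + h + 1), MvPolynomial.homogeneousComponent e f)) =
        Matrix.of fun i j : ι => MvPolynomial.coeff
          (∑ a' ∈ u i, Finsupp.single (Fin.castAdd h a') 1 +
            ∑ c' ∈ w j, Finsupp.single (Fin.natAdd h c') 1) f := by
      ext i j
      rw [Matrix.of_apply, Matrix.of_apply, coeff_truncate_partition]
    rw [hM]
    exact hdet

end Summit.ValiantsHypothesis.ValiantsHypothesis.Theorems.BarrierLever.StrataDoor
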